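import Mathlib.GroupTheory.IndexNormal
import Literature.IUT.HodgeTheaters.PuncturedEllipticCoverings
import HarnessLib

/-!
# [IUTchI] §1: the tower `Π_{X→} ⊆ Π_X̲ ⊆ Π_C̲`, `Π_{X→} ⊆ Π_{C→} ⊆ Π_C̲` of the construction (pp. 37–38)

Mochizuki, *Inter-universal Teichmüller theory I*, §1, kurims pp. 37–38 ([IUTchI] §1 pp.37–38)
[claim: Mochizuki2012, status: disputed].  Companion to `PuncturedEllipticCoverings.lean`: the
group-theoretic definitions `modLKer ≤ deltaEpsKer ≤ jKer`, `piXarrow = Π_{X→}`, `galKer`,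
`piCarrow = Π_{C→}` given there inside `Π_C` are shown here to sit where the printed cartesian
diagrams put them — `Π_{X→} ⊆ Π_X̲`, `Π_{C→} ⊆ Π_C̲`, `Π_{X→} ⊆ Π_{C→}` (p. 38: the arrows of the
cartesian diagram are "open immersions [with normal image] of profinite groups"; earlier on p. 38,
"we have a natural inclusion `J_X ↪ J_C`") — using only the standing data of the set-up
(`[Π_C : Π_X] = 2`, the open subgroups, `Δ_C = Ker(Π_C ↠ G_k)` closed).  These containments are what
the consumer [IUTchI] Def. 3.1 (f) uses: "open subgroups `Π_{X→K} ⊆ Π_{C→K} ⊆ Π_{C_F}`".  Also PROVED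
here (appended; observation of abc-iut-L5-t11): the surjections `Π_{X→} ↠ G_k`, `Π_{C→} ↠ G_k` — the
`aug_piXarrow` clause of `ArrowCoveringClaims` follows from the datum `D_{2ε} ↠ G_k` since
`D_{2ε} ≤ Π_{X→} ≤ Π_{C→}`.  Everything here is PROVED; the finer printed claims (indices `l`, `2l`,
normality, cyclicity, the cartesian equalities) remain the predicate `ArrowCoveringClaims` of the
statement file.  No printed statement is strengthened; no side taken.
-/

namespace Literature.IUT.HodgeTheaters

namespace PuncturedEllipticData

open Literature.AnabelianGeometry.AbsoluteAnabelian

universe u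

variable (D : PuncturedEllipticData.{u})

/-- `Π_X` is normal in `Π_C` (index `2`). ([IUTchI] §1 p.37) [claim: Mochizuki2012, status: disputed] -/
theorem piX_normal : D.PiX.Normal := Subgroup.normal_of_index_eq_two D.index_piX

/-- `Δ_X̲ ⊆ Δ_C̲`. ([IUTchI] §1 p.37) [claim: Mochizuki2012, status: disputed] -/
theorem deltaXbar_le_deltaCbar : D.DeltaXbar ≤ D.DeltaCbar :=
  fun _ hx => ⟨hx.1.2, hx.2⟩

/-- `Δ_X̲ ⊆ Π_X̲`. ([IUTchI] §1 p.37) [claim: Mochizuki2012, status: disputed] -/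
theorem deltaXbar_le_piXbar : D.DeltaXbar ≤ D.PiXbar := inf_le_left

/-- `Δ_C̲ ⊆ Π_C̲`. ([IUTchI] §1 p.37) [claim: Mochizuki2012, status: disputed] -/
theorem deltaCbar_le_piCbar : D.DeltaCbar ≤ D.PiCbar := inf_le_left

/-- `Π_X̲ ⊆ Π_C̲`. ([IUTchI] §1 p.37) [claim: Mochizuki2012, status: disputed] -/
theorem piXbar_le_piCbar : D.PiXbar ≤ D.PiCbar := inf_le_right

/-- `Δ_X̲` is closed in `Π_C` (open subgroups are closed; `Δ_C` is the kernel of the continuous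
augmentation). ([IUTchI] §1 p.37) [claim: Mochizuki2012, status: disputed] -/
theorem isClosed_deltaXbar : IsClosed (D.DeltaXbar : Set D.PiC) := by
  have h1 : IsClosed (D.PiX : Set D.PiC) := D.PiX.isClosed_of_isOpen D.isOpen_piX
  have h2 : IsClosed (D.PiCbar : Set D.PiC) := D.PiCbar.isClosed_of_isOpen D.isOpen_piCbar
  have h3 : IsClosed (D.DeltaC : Set D.PiC) := D.E.isClosed_geom
  exact (h1.inter h2).inter h3

/-- `Δ_X̲` is normal in `Δ_C̲` — indeed normalised by `Π_C̲`: conjugation by `c ∈ Π_C̲` preserves `Π_X`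
(normal), `Π_C̲`, and `Δ_C` (normal). ([IUTchI] §1 p.37) [claim: Mochizuki2012, status: disputed] -/
theorem conj_mem_deltaXbar {x c : D.PiC} (hx : x ∈ D.DeltaXbar) (hc : c ∈ D.PiCbar) :
    c * x * c⁻¹ ∈ D.DeltaXbar := by
  refine ⟨⟨?_, ?_⟩, ?_⟩
  · exact (D.piX_normal).conj_mem x hx.1.1 c
  · exact D.PiCbar.mul_mem (D.PiCbar.mul_mem hc hx.1.2) (D.PiCbar.inv_mem hc)
  · exact D.E.normal_geom.conj_mem x hx.2 c

/-- `Ker(Δ_X̲ ↠ Δ_X̲^{ab} ⊗ ℤ/l) ⊆ Δ_X̲`. ([IUTchI] §1 p.37) [claim: Mochizuki2012, status: disputed] -/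
theorem modLKer_le_deltaXbar : D.modLKer ≤ D.DeltaXbar := by
  refine Subgroup.topologicalClosure_minimal _ ?_ D.isClosed_deltaXbar
  refine sup_le ?_ ?_
  · rw [Subgroup.commutator_le]
    intro a ha b hb
    exact D.DeltaXbar.mul_mem (D.DeltaXbar.mul_mem (D.DeltaXbar.mul_mem ha hb)
      (D.DeltaXbar.inv_mem ha)) (D.DeltaXbar.inv_mem hb)
  · rw [Subgroup.closure_le]
    rintro _ ⟨y, hy, rfl⟩
    exact D.DeltaXbar.pow_mem hy D.l

/-- `I_x ⊆ Δ_X̲` for every cusp `x` of `X̲`. ([IUTchI] §1 p.37) [claim: Mochizuki2012, status: disputed] -/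
theorem inertia_le_deltaXbar (x : D.Cusp) : D.inertia x ≤ D.DeltaXbar :=
  fun _ hz => ⟨D.decomp_le x hz.1, hz.2⟩

/-- `Ker(Δ_X̲ ↠ Δ_ε) ⊆ Δ_X̲`. ([IUTchI] §1 p.37) [claim: Mochizuki2012, status: disputed] -/
theorem deltaEpsKer_le_deltaXbar : D.deltaEpsKer ≤ D.DeltaXbar :=
  sup_le D.modLKer_le_deltaXbar (iSup_le fun x => D.inertia_le_deltaXbar x.1)

/-- `Ker(Δ_X̲ ↠ Δ_ε⁺) ⊆ Δ_X̲`: the commutators `x c x⁻¹ c⁻¹` (`x ∈ Δ_X̲`, `c ∈ Δ_C̲`) lie in `Δ_X̲` by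
normality. ([IUTchI] §1 p.38) [claim: Mochizuki2012, status: disputed] -/
theorem jKer_le_deltaXbar : D.jKer ≤ D.DeltaXbar := by
  refine sup_le D.deltaEpsKer_le_deltaXbar ?_
  rw [Subgroup.closure_le]
  rintro _ ⟨x, hx, c, hc, -, rfl⟩
  have h := D.conj_mem_deltaXbar (D.DeltaXbar.inv_mem hx) (D.deltaCbar_le_piCbar hc)
  have : x * c * x⁻¹ * c⁻¹ = x * (c * x⁻¹ * c⁻¹) := by group
  rw [this]
  exact D.DeltaXbar.mul_mem hx h

/-- `Π_{X→} ⊆ Π_X̲` (p. 38, the cartesian diagram `Π_{X→} ↪ Π_X̲`). ([IUTchI] §1 p.38)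
[claim: Mochizuki2012, status: disputed] -/
theorem piXarrow_le_piXbar : D.piXarrow ≤ D.PiXbar :=
  sup_le (D.decomp_le D.twoε) (D.jKer_le_deltaXbar.trans D.deltaXbar_le_piXbar)

/-- The inverse image of `Gal(X̲/C̲)` lies in `Δ_C̲`. ([IUTchI] §1 p.38) [claim: Mochizuki2012, status: disputed] -/
theorem galKer_le_deltaCbar : D.galKer ≤ D.DeltaCbar := by
  refine sup_le (D.jKer_le_deltaXbar.trans D.deltaXbar_le_deltaCbar) ?_
  rw [Subgroup.closure_le]
  rintro _ ⟨y, hy, rfl⟩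
  exact D.DeltaCbar.pow_mem hy D.l

/-- `Π_{C→} ⊆ Π_C̲` (p. 38, the cartesian diagram `Π_{C→} ↪ Π_C̲`). ([IUTchI] §1 p.38)
[claim: Mochizuki2012, status: disputed] -/
theorem piCarrow_le_piCbar : D.piCarrow ≤ D.PiCbar :=
  sup_le ((D.decomp_le D.twoε).trans D.piXbar_le_piCbar)
    (D.galKer_le_deltaCbar.trans D.deltaCbar_le_piCbar)

/-- `Π_{X→} ⊆ Π_C̲`. ([IUTchI] §1 p.38) [claim: Mochizuki2012, status: disputed] -/
theorem piXarrow_le_piCbar : D.piXarrow ≤ D.PiCbar :=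
  D.piXarrow_le_piCarrow.trans D.piCarrow_le_piCbar

/-- `Π_{X→} ⊆ Π_X̲ ∩ Π_{C→}` — the inclusion half of the printed cartesian square (equality is the
claim `ArrowCoveringClaims.cartesian`). ([IUTchI] §1 p.38) [claim: Mochizuki2012, status: disputed] -/
theorem piXarrow_le_inf : D.piXarrow ≤ D.PiXbar ⊓ D.piCarrow :=
  le_inf D.piXarrow_le_piXbar D.piXarrow_le_piCarrow

/-- `Π_{X→} ∩ Δ_C ⊇ Ker(Δ_X̲ ↠ Δ_ε⁺)` — the inclusion half of "`σ` is a section" (equality is the claim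
`ArrowCoveringClaims.piXarrow_inf_delta`). ([IUTchI] §1 p.38) [claim: Mochizuki2012, status: disputed] -/
theorem jKer_le_piXarrow_inf_delta : D.jKer ≤ D.piXarrow ⊓ D.DeltaC :=
  le_inf le_sup_right (D.jKer_le_deltaXbar.trans (inf_le_right))

/-! ### The surjections `Π_{X→} ↠ G_k`, `Π_{C→} ↠ G_k` (p. 38) -/

/-- `D_{2ε} ≤ Π_{X→}` (by construction, `Π_{X→} = D_{2ε} · jKer`). ([IUTchI] §1 p.38)
[claim: Mochizuki2012, status: disputed] -/
theorem decomp_twoε_le_piXarrow : D.decomp D.twoε ≤ D.piXarrow := le_sup_left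

/-- `D_{2ε} ≤ Π_{C→}`. ([IUTchI] §1 p.38) [claim: Mochizuki2012, status: disputed] -/
theorem decomp_twoε_le_piCarrow : D.decomp D.twoε ≤ D.piCarrow := le_sup_left

/-- `Π_{X→} ↠ G_k` (p. 38: `σ : G_k → J_C` is a section of `J_C ↠ G_k` with `Im(σ) ⊆ J_X`, and `Π_{X→}`
is the inverse image of `Im(σ)`) — the clause `ArrowCoveringClaims.aug_piXarrow` is DERIVABLE from
the datum `D_{2ε} ↠ G_k` (`aug_decomp_twoε`) since `D_{2ε} ≤ Π_{X→}` (observation of abc-iut-L5-t11,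
kernel-checked there; landed here by the module's companion writer). ([IUTchI] §1 p.38)
[claim: Mochizuki2012, status: disputed] -/
theorem aug_piXarrow_surjective :
    Function.Surjective (D.E.aug.toMonoidHom.comp D.piXarrow.subtype) := by
  intro g
  obtain ⟨⟨d, hd⟩, hdg⟩ := D.aug_decomp_twoε g
  exact ⟨⟨d, D.decomp_twoε_le_piXarrow hd⟩, hdg⟩

/-- `Π_{C→} ↠ G_k` likewise (p. 38: `Π_{C→}` is the inverse image of `Im(σ) × Gal(X̲/C̲) ⊆ J_C` and
contains `D_{2ε}`). ([IUTchI] §1 p.38) [claim: Mochizuki2012, status: disputed] -/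
theorem aug_piCarrow_surjective :
    Function.Surjective (D.E.aug.toMonoidHom.comp D.piCarrow.subtype) := by
  intro g
  obtain ⟨⟨d, hd⟩, hdg⟩ := D.aug_decomp_twoε g
  exact ⟨⟨d, D.decomp_twoε_le_piCarrow hd⟩, hdg⟩

/-- Hence an `ArrowCoveringClaims` witness needs one field fewer: any proof of the remaining clauses
extends by `aug_piXarrow_surjective`. ([IUTchI] §1 p.38) [claim: Mochizuki2012, status: disputed] -/
theorem arrowCoveringClaims_iff_of_aug : D.ArrowCoveringClaims ↔
    ((D.jKer.subgroupOf D.PiCbar).Normal ∧ D.jKer.relIndex D.DeltaXbar = D.l ∧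
      D.inertia D.ε1 ⊔ D.jKer = D.DeltaXbar ∧ D.inertia D.ε2 ⊔ D.jKer = D.DeltaXbar ∧
      D.piXarrow ⊓ D.DeltaC = D.jKer ∧ D.piXarrow = D.PiXbar ⊓ D.piCarrow ∧
      (D.piXarrow.subgroupOf D.PiCbar).Normal ∧ (D.piCarrow.subgroupOf D.PiCbar).Normal ∧
      D.piXarrow.relIndex D.PiCbar = 2 * D.l ∧ D.piCarrow.relIndex D.PiCbar = D.l ∧
      (∀ [(D.piXarrow.subgroupOf D.PiCbar).Normal],
        IsCyclic (D.PiCbar ⧸ D.piXarrow.subgroupOf D.PiCbar)) ∧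
      ∀ [(D.piCarrow.subgroupOf D.PiCbar).Normal],
        IsCyclic (D.PiCbar ⧸ D.piCarrow.subgroupOf D.PiCbar)) := by
  constructor
  · intro h
    exact ⟨h.jKer_normal, h.jKer_relindex, h.inertia_ε1_sup, h.inertia_ε2_sup, h.piXarrow_inf_delta,
      h.cartesian, h.piXarrow_normal, h.piCarrow_normal, h.piXarrow_relindex, h.piCarrow_relindex,
      h.galX_cyclic, h.galC_cyclic⟩
  · rintro ⟨h1, h2, h3, h4, h5, h6, h7, h8, h9, h10, h11, h12⟩
    exact ⟨h1, h2, h3, h4, h5, D.aug_piXarrow_surjective, h6, h7, h8, h9, h10, h11, h12⟩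

end PuncturedEllipticData

end Literature.IUT.HodgeTheaters
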